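import Mathlib
import Summits.AtomisticToContinuum.Crystallization.Theses.PhononSlackCertificates
import Summits.AtomisticToContinuum.Crystallization.Theorems.PhononSlackCertificatesNearFieldConvexityStubPnfOfLocalCertificate

/-!
# Route `PhononSlackCertificates`, crux `NearFieldConvexity` (stmt-AtomisticToContinuum-13958), line `Sketch`:
stub `stub_pnfOfLocalCertificate8` — PNF from the RADIUS-8 local certificate

Skeleton v11 weakens the certificate obligation of the line from the radius-4 to the radius-8 interior of the good
cluster `Ω`: the pointwise calibrated inequality (self-site excess plus an antisymmetric `r⁻⁶`-dominated transfer) is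
required only at particles whose 8-ball lies in `Ω`.  The price is the thicker collar `B₈ = Ω ∖ int₈Ω`, whose size is
controlled by the crux's boundary count `#∂₄Ω` through the landed pair count at scale `ℓ = 17/4`
(`stub_pairCountOfCrossing`: every `i ∈ B₈ ∩ int₄Ω` has a non-member within `8 < 2ℓ`, so
`#(B₈ ∩ int₄Ω) ≤ C(17/4)⁴·#∂₄Ω`).  The rest is the abstract bookkeeping `lc_bookkeeping` of the radius-4 file
(antisymmetry cancellation, flux envelope into the collar, collar floor, `#NL(Ω) ≤ #NL(int) + #collar`).
-/

noncomputable section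

open scoped BigOperators
open Literature.MathematicalPhysics.StatisticalMechanics Literature.Geometry.DiscreteGeometry

namespace Summit.AtomisticToContinuum.Crystallization.Theorems.PhononSlackNearFieldConvexity

/-- **Collar count.**  For a set `Ω` (of good particles of a separated configuration), the radius-8 collar
`B₈ = {i ∈ Ω : some non-member within 8}` has at most `#∂₄Ω + Σ_{i∈int₄Ω} #{j ∉ Ω : |x i − x j| < 17/2}` elements
(the radius-4 collar, plus, inside the radius-4 interior, sites witnessed by the pair count at scale `17/4`).
[folklore] -/
theorem collar8_card_le {N : ℕ} (x : Fin N → EuclideanSpace ℝ (Fin 3)) (Ω : Finset (Fin N)) :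
    ((Ω.filter fun i => ∃ j : Fin N, j ∉ Ω ∧ dist (x j) (x i) ≤ 8).card : ℝ) ≤
      ((Ω.filter fun i => ∃ j : Fin N, j ∉ Ω ∧ dist (x j) (x i) ≤ 4).card : ℝ) +
        ∑ i ∈ Ω.filter (fun i => ∀ j : Fin N, dist (x j) (x i) ≤ 4 → j ∈ Ω),
          ((Finset.univ.filter (fun j => j ∉ Ω ∧ dist (x i) (x j) < 2 * (17 / 4 : ℝ))).card : ℝ) := by
  classical
  set B8 := Ω.filter fun i => ∃ j : Fin N, j ∉ Ω ∧ dist (x j) (x i) ≤ 8 with hB8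
  set B4 := Ω.filter fun i => ∃ j : Fin N, j ∉ Ω ∧ dist (x j) (x i) ≤ 4 with hB4
  set I4 := Ω.filter (fun i => ∀ j : Fin N, dist (x j) (x i) ≤ 4 → j ∈ Ω) with hI4
  set D := I4.filter fun i => ∃ j : Fin N, j ∉ Ω ∧ dist (x j) (x i) ≤ 8 with hD
  -- `B8 ⊆ B4 ∪ D`
  have hsub : B8 ⊆ B4 ∪ D := by
    intro i hi
    rw [hB8, Finset.mem_filter] at hi
    rw [Finset.mem_union]
    by_cases h4 : ∃ j : Fin N, j ∉ Ω ∧ dist (x j) (x i) ≤ 4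
    · exact Or.inl (Finset.mem_filter.2 ⟨hi.1, h4⟩)
    · refine Or.inr (Finset.mem_filter.2 ⟨Finset.mem_filter.2 ⟨hi.1, ?_⟩, hi.2⟩)
      intro j hd
      by_contra hj
      exact h4 ⟨j, hj, hd⟩
  have h1 : (B8.card : ℝ) ≤ (B4.card : ℝ) + (D.card : ℝ) := by
    exact_mod_cast (Finset.card_le_card hsub).trans (Finset.card_union_le _ _)
  -- `#D ≤ Σ_{i∈I4} #{j ∉ Ω : dist < 17/2}` : each `i ∈ D` contributes at least one such `j`
  have h2 : (D.card : ℝ) ≤ ∑ i ∈ I4,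
      ((Finset.univ.filter (fun j => j ∉ Ω ∧ dist (x i) (x j) < 2 * (17 / 4 : ℝ))).card : ℝ) := by
    have hD' : (D.card : ℝ) = ∑ i ∈ I4, (if ∃ j : Fin N, j ∉ Ω ∧ dist (x j) (x i) ≤ 8 then (1 : ℝ) else 0) := by
      rw [Finset.sum_ite, Finset.sum_const_zero, add_zero, Finset.sum_const, nsmul_eq_mul, mul_one, hD]
    rw [hD']
    refine Finset.sum_le_sum fun i _ => ?_
    split_ifs with h
    · obtain ⟨j, hj, hd⟩ := h
      have hmem : j ∈ Finset.univ.filter (fun j => j ∉ Ω ∧ dist (x i) (x j) < 2 * (17 / 4 : ℝ)) := by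
        rw [Finset.mem_filter]
        refine ⟨Finset.mem_univ j, hj, ?_⟩
        rw [dist_comm]
        linarith
      have : (1 : ℝ) ≤ ((Finset.univ.filter (fun j => j ∉ Ω ∧ dist (x i) (x j) < 2 * (17 / 4 : ℝ))).card : ℝ) := by
        exact_mod_cast Finset.one_le_card.2 ⟨j, hmem⟩
      exact this
    · exact Nat.cast_nonneg _
  linarith

/-- **Stub (bookkeeping, lead): PNF from the radius-8 local certificate.**  Sum the pointwise inequality over the
radius-8 interior `I₈` of `Ω`: internal transfers cancel by antisymmetry, the flux into the collar `B₈ = Ω ∖ I₈` is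
`≤ 250·|M|·δ⁻⁶·#B₈` by the flux envelope, collar sites are floored by the self-site floor, `#NL(Ω) ≤ #NL(I₈) + #B₈`, and
`#B₈ ≤ (1 + |C|(17/4)⁴)·#∂₄Ω` by the collar count and the pair count at scale `17/4`.  Constants: `c := c`,
`C' := (c + (250/12)δ⁻⁶ + 250|M|δ⁻⁶)·(1 + |C|(17/4)⁴)`. -/
theorem stub_pnfOfLocalCertificate8
    (hfloor : ∀ (N : ℕ) (x : Fin N → EuclideanSpace ℝ (Fin 3)) (δ : ℝ), 0 < δ →
            (∀ i j : Fin N, i ≠ j → δ ≤ dist (x i) (x j)) →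
            ∀ (Ω : Finset (Fin N)) (i : Fin N),
              -(250 / 12 * δ⁻¹ ^ 6) ≤ (1 / 2 : ℝ) * (∑ j ∈ Ω.erase i, lennardJones (dist (x i) (x j))) -
                (⨅ Q : PeriodicConfiguration 3, Q.energyPerParticle lennardJones))
    (hflux : ∀ (N : ℕ) (x : Fin N → EuclideanSpace ℝ (Fin 3)) (δ : ℝ), 0 < δ →
            (∀ i j : Fin N, i ≠ j → δ ≤ dist (x i) (x j)) →
            ∀ (A B : Finset (Fin N)), Disjoint A B →
              ∑ i ∈ A, ∑ j ∈ B, (dist (x i) (x j))⁻¹ ^ 6 ≤ 250 * δ⁻¹ ^ 6 * (B.card : ℝ))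
    (hpc : ∀ δ : ℝ, 0 < δ → ∃ C : ℝ, ∀ (N : ℕ) (x : Fin N → EuclideanSpace ℝ (Fin 3)),
            (∀ i j : Fin N, i ≠ j → δ ≤ dist (x i) (x j)) →
            ∀ Ω : Finset (Fin N), (∀ i ∈ Ω, IsTwoShellGood (1 / 20) (47 / 50) 1 x i) →
            ∀ ℓ : ℝ, 4 ≤ ℓ →
              (∑ i ∈ Ω.filter (fun i => ∀ j : Fin N, dist (x j) (x i) ≤ 4 → j ∈ Ω),
                  ((Finset.univ.filter (fun j => j ∉ Ω ∧ dist (x i) (x j) < 2 * ℓ)).card : ℝ)) ≤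
                C * ℓ ^ 4 * (Nat.card {i : Fin N // i ∈ Ω ∧ ∃ j : Fin N, j ∉ Ω ∧ dist (x j) (x i) ≤ 4} : ℝ))
    (hLC : ∀ δ : ℝ, 0 < δ → ∀ η : ℝ, 0 < η → ∃ c : ℝ, 0 < c ∧ ∃ M : ℝ, ∀ (N : ℕ) (x : Fin N → EuclideanSpace ℝ (Fin 3)),
            (∀ i j : Fin N, i ≠ j → δ ≤ dist (x i) (x j)) →
            ∀ Ω : Finset (Fin N), (∀ i ∈ Ω, IsTwoShellGood (1 / 20) (47 / 50) 1 x i) →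
              ∃ τ : Fin N → Fin N → ℝ, (∀ i j, τ i j = -τ j i) ∧ (∀ i j, |τ i j| ≤ M * (dist (x i) (x j))⁻¹ ^ 6) ∧
                ∀ i ∈ Ω, (∀ k : Fin N, dist (x k) (x i) ≤ 8 → k ∈ Ω) →
                  0 ≤ ((1 / 2 : ℝ) * (∑ j ∈ Ω.erase i, lennardJones (dist (x i) (x j))) - (⨅ Q : PeriodicConfiguration 3, Q.energyPerParticle lennardJones)) + ∑ j ∈ Ω, τ i j ∧
                  (¬ (∃ (A : EuclideanSpace ℝ (Fin 3) →ₗᵢ[ℝ] EuclideanSpace ℝ (Fin 3)) (t : EuclideanSpace ℝ (Fin 3)) (a : ℝ) (s : ℤ → ℤ) (z : ℤ → ℝ), 47 / 50 ≤ a ∧ a ≤ 1 ∧ IsHaggSeq s ∧ (∀ m : ℤ, 39 / 50 * a ≤ z (m + 1) - z m ∧ z (m + 1) - z m ≤ 17 / 20 * a) ∧ (fun S : Set (EuclideanSpace ℝ (Fin 3)) => (∀ j : Fin N, dist (x j) (x i) ≤ 2 → ∃ p ∈ S, dist (x j + t) p ≤ η) ∧ (∀ p ∈ S, dist p (x i +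 t) ≤ 2 → ∃ j : Fin N, dist (x j + t) p ≤ η)) {p | ∃ m i j : ℤ, p = A (((i : ℝ) • triangularVec₁ a) + ((j : ℝ) • triangularVec₂ a) + ((haggLabel s m : ℝ) • barlowOffset a) + (z m • layerNormal 1))}) →
                    c ≤ ((1 / 2 : ℝ) * (∑ j ∈ Ω.erase i, lennardJones (dist (x i) (x j))) - (⨅ Q : PeriodicConfiguration 3, Q.energyPerParticle lennardJones)) + ∑ j ∈ Ω, τ i j)) :
    ∀ δ : ℝ, 0 < δ → ∀ η : ℝ, 0 < η → ∃ c : ℝ, 0 < c ∧ ∃ C : ℝ, ∀ (N : ℕ) (x : Fin N → EuclideanSpace ℝ (Fin 3)), (∀ i j : Fin N, i ≠ j → δ ≤ dist (x i) (x j)) → ∀ Ω : Finset (Fin N), (∀ i ∈ Ω, IsTwoShellGood (1 / 20) (47 / 50) 1 x i) → c * (Nat.card {i : Fin N // i ∈ Ω ∧ ¬ (∃ (A : EuclideanSpace ℝ (Fin 3) →ₗᵢ[ℝ] EuclideanSpace ℝ (Fin 3)) (t : EuclideanSpace ℝ (Fin 3)) (a : ℝ) (s : ℤ → ℤ) (z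 : ℤ → ℝ), 47 / 50 ≤ a ∧ a ≤ 1 ∧ IsHaggSeq s ∧ (∀ m : ℤ, 39 / 50 * a ≤ z (m + 1) - z m ∧ z (m + 1) - z m ≤ 17 / 20 * a) ∧ (fun S : Set (EuclideanSpace ℝ (Fin 3)) => (∀ j : Fin N, dist (x j) (x i) ≤ 2 → ∃ p ∈ S, dist (x j + t) p ≤ η) ∧ (∀ p ∈ S, dist p (x i + t) ≤ 2 → ∃ j : Fin N, dist (x j + t) p ≤ η)) {p | ∃ m i j : ℤ, p = A (((i : ℝ) • triangularVec₁ a) + ((j : ℝ) • triangularVec₂ a) + ((haggLabel s m : ℝ) • barlowOffset a) + (z m • layerNormal 1))})} : ℝ) - C * (Nat.card {i : Fin N // i ∈ Ω ∧ ∃ j : Fin N, j ∉ Ω ∧ dist (x j) (x i) ≤ 4} : ℝ) ≤ (∑ i ∈ Ω, (1 / 2 : ℝ) * (∑ j ∈ Ω.erase i, lennardJones (dist (x i) (x j)))) - (Ω.card : ℝ) * (⨅ Q : PeriodicConfiguration 3, Q.energyPerParticle lennardJones) := by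
  intro δ hδ η hη
  obtain ⟨c, hc, M, hM⟩ := hLC δ hδ η hη
  obtain ⟨Cp, hCp⟩ := hpc δ hδ
  set K : ℝ := 1 + |Cp| * (17 / 4 : ℝ) ^ 4 with hKdef
  refine ⟨c, hc, (c + 250 / 12 * δ⁻¹ ^ 6 + 250 * |M| * δ⁻¹ ^ 6) * K, ?_⟩
  intro N x hsep Ω hΩ
  obtain ⟨τ, hτ, hτM, hpt⟩ := hM N x hsep Ω hΩ
  classical
  -- radius-8 interior and collar of `Ω`
  set I : Finset (Fin N) := Ω.filter (fun i => ∀ k : Fin N, dist (x k) (x i) ≤ 8 → k ∈ Ω) with hIdef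
  set B : Finset (Fin N) := Ω.filter (fun i => ∃ j : Fin N, j ∉ Ω ∧ dist (x j) (x i) ≤ 8) with hBdef
  rw [lc_natCard_eq, lc_natCard_eq]
  have hIΩ : I ⊆ Ω := Finset.filter_subset _ _
  have hBmem : ∀ i, i ∈ B ↔ i ∈ Ω ∧ i ∉ I := by
    intro i
    simp only [hBdef, hIdef, Finset.mem_filter]
    constructor
    · rintro ⟨hi, j, hj, hd⟩
      exact ⟨hi, fun h' => hj (h'.2 j hd)⟩
    · rintro ⟨hi, h'⟩
      refine ⟨hi, ?_⟩
      by_contra hne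
      exact h' ⟨hi, fun j hd => by_contra fun hj => hne ⟨j, hj, hd⟩⟩
  have hdisj : Disjoint I B := by
    rw [Finset.disjoint_left]
    intro i hiI hiB
    exact ((hBmem i).1 hiB).2 hiI
  -- the flux into the collar, by the envelope
  have hfluxIB : ∑ i ∈ I, ∑ j ∈ B, τ i j ≤ 250 * |M| * δ⁻¹ ^ 6 * (B.card : ℝ) := by
    have h1 : ∑ i ∈ I, ∑ j ∈ B, τ i j ≤ ∑ i ∈ I, ∑ j ∈ B, |M| * (dist (x i) (x j))⁻¹ ^ 6 := by
      refine Finset.sum_le_sum fun i _ => Finset.sum_le_sum fun j _ => ?_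
      have hb := hτM i j
      have h0 : (0 : ℝ) ≤ (dist (x i) (x j))⁻¹ ^ 6 := by positivity
      calc τ i j ≤ |τ i j| := le_abs_self _
        _ ≤ M * (dist (x i) (x j))⁻¹ ^ 6 := hb
        _ ≤ |M| * (dist (x i) (x j))⁻¹ ^ 6 := mul_le_mul_of_nonneg_right (le_abs_self M) h0
    have h2 : ∑ i ∈ I, ∑ j ∈ B, |M| * (dist (x i) (x j))⁻¹ ^ 6 =
        |M| * ∑ i ∈ I, ∑ j ∈ B, (dist (x i) (x j))⁻¹ ^ 6 := by
      rw [Finset.mul_sum]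
      refine Finset.sum_congr rfl fun i _ => ?_
      rw [Finset.mul_sum]
    have h3 := hflux N x δ hδ hsep I B hdisj
    have hM0 : 0 ≤ |M| := abs_nonneg M
    rw [h2] at h1
    nlinarith [h1, h3, hM0]
  -- the abstract bookkeeping (radius-8 interior)
  have key := lc_bookkeeping
    (fun i : Fin N => ¬ (∃ (A : EuclideanSpace ℝ (Fin 3) →ₗᵢ[ℝ] EuclideanSpace ℝ (Fin 3)) (t : EuclideanSpace ℝ (Fin 3)) (a : ℝ) (s : ℤ → ℤ) (z : ℤ → ℝ), 47 / 50 ≤ a ∧ a ≤ 1 ∧ IsHaggSeq s ∧ (∀ m : ℤ, 39 / 50 * a ≤ z (m + 1) - z m ∧ z (m + 1) - z m ≤ 17 / 20 * a) ∧ (fun S : Set (EuclideanSpace ℝ (Fin 3)) => (∀ j : Fin N, dist (x j) (x i) ≤ 2 → ∃ p ∈ S, dist (x j + t) p ≤ η) ∧ (∀ p ∈ S, dist p (x i + t) ≤ 2 → ∃ j : Fin N, dist (x j + t) p ≤ η)) {p | ∃ m i j : ℤ, p = A (((i : ℝ) • triangularVec₁ a) + ((j : ℝ) • triangularVec₂ a)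 + ((haggLabel s m : ℝ) • barlowOffset a) + (z m • layerNormal 1))}))
    (fun i : Fin N => (1 / 2 : ℝ) * (∑ j ∈ Ω.erase i, lennardJones (dist (x i) (x j))) - (⨅ Q : PeriodicConfiguration 3, Q.energyPerParticle lennardJones))
    τ Ω I B hc hτ hIΩ hBmem
    (fun i hi => hpt i (hIΩ hi) (Finset.mem_filter.1 hi).2)
    hfluxIB
    (fun i _ => hfloor N x δ hδ hsep Ω i)
  -- the collar count: `#B ≤ K · #∂₄Ω`
  have hcol := collar8_card_le x Ω
  have hpair := hCp N x hsep Ω hΩ (17 / 4) (by norm_num)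
  rw [lc_natCard_eq] at hpair
  set B4c : ℝ := ((Ω.filter fun i => ∃ j : Fin N, j ∉ Ω ∧ dist (x j) (x i) ≤ 4).card : ℝ) with hB4c
  have hB40 : 0 ≤ B4c := Nat.cast_nonneg _
  have hBle : (B.card : ℝ) ≤ K * B4c := by
    have h1 : (B.card : ℝ) ≤ B4c + Cp * (17 / 4 : ℝ) ^ 4 * B4c := by
      have := hcol
      rw [← hBdef] at this
      linarith
    have h2 : Cp * (17 / 4 : ℝ) ^ 4 * B4c ≤ |Cp| * (17 / 4 : ℝ) ^ 4 * B4c :=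
      mul_le_mul_of_nonneg_right (mul_le_mul_of_nonneg_right (le_abs_self Cp) (by positivity)) hB40
    rw [hKdef]
    nlinarith
  have hRHS : (∑ i ∈ Ω, (1 / 2 : ℝ) * (∑ j ∈ Ω.erase i, lennardJones (dist (x i) (x j)))) -
      (Ω.card : ℝ) * (⨅ Q : PeriodicConfiguration 3, Q.energyPerParticle lennardJones) =
      ∑ i ∈ Ω, ((1 / 2 : ℝ) * (∑ j ∈ Ω.erase i, lennardJones (dist (x i) (x j))) - (⨅ Q : PeriodicConfiguration 3, Q.energyPerParticle lennardJones)) := by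
    rw [Finset.sum_sub_distrib, Finset.sum_const, nsmul_eq_mul]
  rw [hRHS]
  have hB0 : (0 : ℝ) ≤ (B.card : ℝ) := Nat.cast_nonneg _
  have hcoef : 0 ≤ c + 250 / 12 * δ⁻¹ ^ 6 + 250 * |M| * δ⁻¹ ^ 6 := by positivity
  have hstep : (c + 250 / 12 * δ⁻¹ ^ 6 + 250 * |M| * δ⁻¹ ^ 6) * (B.card : ℝ) ≤
      (c + 250 / 12 * δ⁻¹ ^ 6 + 250 * |M| * δ⁻¹ ^ 6) * (K * B4c) :=
    mul_le_mul_of_nonneg_left hBle hcoef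
  nlinarith [key, hstep, hB0]

end Summit.AtomisticToContinuum.Crystallization.Theorems.PhononSlackNearFieldConvexity
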